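import Summits.AtomisticToContinuum.HydrodynamicLimit.Theorems.AntiMazurCoboundariesKineticFluxLdDecayHTheoremObjectsE
import Summits.AtomisticToContinuum.HydrodynamicLimit.Theorems.AntiMazurCoboundariesKineticFluxLdDecayWindowDuality
import Summits.AtomisticToContinuum.HydrodynamicLimit.Theorems.AntiMazurCoboundariesKineticFluxLdDecayOneBodyMarginal
import Summits.AtomisticToContinuum.HydrodynamicLimit.Theorems.AntiMazurCoboundariesKineticFluxLdDecayVelocityEntropyBudget
import HarnessLib

/-!
# Entropic negligibility of the optimal enemy gives the core of reshape 4
# (crux `KineticFluxLdDecay`, stmt-AtomisticToContinuum-10967; line `h-theorem-dissipation-budget`, lead c5, reshape 4)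

Registered stub `stub_vanishing_of_tiltEntropy` of the skeleton (objects part E,
`Theorems/AntiMazurCoboundariesKineticFluxLdDecayHTheoremObjectsE.lean`):

  `ProductionContinuity → SecondMomentBudget → TiltEntropyVanishing → VanishingWindowDissipationTilt`.

Composition-level glue, pointwise in time. Given the admissible data `(φ, g)`, a cut `K ≥ 1` and a tolerance
`η > 0`: `ProductionContinuity` at the second-moment bound `M = c₂ + 4` yields an entropy threshold `η' > 0`;
`TiltEntropyVanishing` at `ε = min η' 1` yields the window `τ` and `N₀`. For `N ≥ N₀` and a flow `Φ`, the tilted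
law `ν = G_N^X` is a probability law `≪ G_N` of finite relative entropy `S ≤ ε (N+1)` (`stub_windowDuality`);
at each time `t` its reduced one-body law `f_t` is a probability law `≪ vol ⊗ γ` (`stub_oneBodyMarginal`) with
`(N+1)·KL(f_t ‖ (f_t)₁ ⊗ γ) ≤ S` (`stub_velocityEntropyBudget`), hence velocity entropy `≤ η'`, and second
velocity moment `≤ c₂ + 4 S/(N+1) ≤ c₂ + 4` (`SecondMomentBudget`); so its cut production is `≤ η`
(`ProductionContinuity`; the cut expression is `cutDensity` by `stub_hTheoremObjectsD`). Integrating the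
constant bound over the window `(0, h)` gives `≤ η · h`.
-/

noncomputable section

open MeasureTheory ProbabilityTheory Set Filter InformationTheory
open scoped ENNReal

namespace Summit.AtomisticToContinuum.HydrodynamicLimit.Theorems.HTheorem

open Literature.MathematicalPhysics.KineticTheory (T3 V3 hsDiameter localGibbsLaw)
open Literature.Analysis.FluidPDE (HardSphereFlow Config)

namespace VanishingOfTiltEntropy

/-- Arithmetic of the entropy budget: if `n · v ≤ S ≤ ε · n` with `n > 0` then `v ≤ ε`. -/
theorem le_of_mul_le_of_le_mul {n v S ε : ℝ} (hn : 0 < n) (h1 : n * v ≤ S) (h2 : S ≤ ε * n) : v ≤ ε := by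
  have h : n * v ≤ n * ε := by
    calc n * v ≤ S := h1
      _ ≤ ε * n := h2
      _ = n * ε := mul_comm _ _
  exact le_of_mul_le_mul_left h hn

/-- Arithmetic of the second-moment budget: if `0 ≤ S ≤ n` with `n > 0` then `c + 4 S / n ≤ c + 4`. -/
theorem moment_bound_arith {c S n : ℝ} (hn : 0 < n) (hS : S ≤ n) : c + 4 * S / n ≤ c + 4 := by
  have h1 : S / n ≤ 1 := (div_le_one hn).2 hS
  have h2 : 4 * S / n = 4 * (S / n) := mul_div_assoc _ _ _
  rw [h2]
  linarith

/-- Integrating a constant bound over the window: if `P t ≤ η` for every `t` then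
`∫⁻_{(0,h)} P ≤ η · h` (`η ≥ 0`; for `h ≤ 0` both sides vanish). -/
theorem setLIntegral_Ioo_le_of_le {P : ℝ → ℝ≥0∞} {η : ℝ} (h : ℝ) (hη : 0 ≤ η)
    (hP : ∀ t, P t ≤ ENNReal.ofReal η) :
    ∫⁻ t in Set.Ioo 0 h, P t ≤ ENNReal.ofReal (η * h) := by
  calc ∫⁻ t in Set.Ioo 0 h, P t ≤ ∫⁻ _t in Set.Ioo 0 h, ENNReal.ofReal η := lintegral_mono fun t => hP t
    _ = ENNReal.ofReal η * ENNReal.ofReal h := by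
        rw [lintegral_const, Measure.restrict_apply MeasurableSet.univ, Set.univ_inter, Real.volume_Ioo,
          sub_zero]
    _ = ENNReal.ofReal (η * h) := by rw [← ENNReal.ofReal_mul hη]

end VanishingOfTiltEntropy

open VanishingOfTiltEntropy in
/-- **Entropic negligibility of the optimal enemy gives the core of reshape 4** (registered stub
`stub_vanishing_of_tiltEntropy` of skeleton 1c449378, line `h-theorem-dissipation-budget`):
`ProductionContinuity → SecondMomentBudget → TiltEntropyVanishing → VanishingWindowDissipationTilt`.
Pointwise in time: the tilted law has entropy `≤ ε(N+1)`, so each reduced one-body law has velocity entropy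
`≤ ε ≤ η'` and second moment `≤ c₂ + 4`, whence cut production `≤ η` by continuity of the production at the
Maxwellian; integrate over the window. -/
theorem stub_vanishing_of_tiltEntropy :
    ProductionContinuity → SecondMomentBudget → TiltEntropyVanishing → VanishingWindowDissipationTilt := by
  intro hPC hSM hTE a θ u₀ ha hθ
  obtain ⟨c₂, hc₂, H2⟩ := hSM
  obtain ⟨σ₁, hσ₁, H3⟩ := hTE a θ u₀ ha hθ
  refine ⟨min σ₁ (1 / 2), lt_min hσ₁ (by norm_num), fun σ hσ hσlt => ?_⟩
  have hσ1 : σ < σ₁ := hσlt.trans_le (min_le_left _ _)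
  have hσ2 : σ ≤ 1 / 2 := (hσlt.trans_le (min_le_right _ _)).le
  obtain ⟨κb, hκb, H3'⟩ := H3 σ hσ hσ1
  refine ⟨κb, hκb, fun φ g hφ hg hφ1 hgκ horth K hK η hη => ?_⟩
  have hK0 : 0 ≤ K := zero_le_one.trans hK
  have hM : 0 ≤ c₂ + 4 := by positivity
  -- entropy threshold of the production continuity at second-moment bound `M = c₂ + 4`
  obtain ⟨η', hη', HPC⟩ := hPC K hK0 (c₂ + 4) hM η hη
  have hε : 0 < min η' 1 := lt_min hη' one_pos
  -- window and threshold `N₀` of the entropic negligibility at `ε = min η' 1`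
  obtain ⟨τ, hτ, N₀, hN⟩ := H3' φ g hφ hg hφ1 hgκ horth (min η' 1) hε
  refine ⟨τ, hτ, N₀, fun N hNN Φ => ?_⟩
  have hKL := hN N hNN Φ
  haveI hGP : IsProbabilityMeasure (gibbs σ a θ u₀ N Φ) := isProbabilityMeasure_gibbs ha hθ hσ2 u₀ N Φ
  have hgood : gibbs σ a θ u₀ N Φ Φ.goodᶜ = 0 :=
    gibbs_absolutelyContinuous σ a θ u₀ N Φ Φ.measure_compl_good
  have hFm : Measurable (fluxObs θ u₀ φ g N) := measurable_fluxObs θ u₀ hφ.measurable hg.measurable N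
  have hFb : ∀ z, |fluxObs θ u₀ φ g N z| ≤ ((N + 1 : ℕ) : ℝ) * κb := abs_fluxObs_le θ u₀ hφ1 hgκ N
  have hh : 0 < window τ N := mul_pos hτ (Real.rpow_pos_of_pos (by positivity) _)
  obtain ⟨hνP, hνac, hνkl, -, -, -⟩ :=
    stub_windowDuality _ _ Φ (gibbs σ a θ u₀ N Φ) hGP hgood (fluxObs θ u₀ φ g N) hFm ⟨_, hFb⟩
      (window τ N) hh
  -- `tiltedGibbs … = (gibbs …).tilted (windowAvg Φ (fluxObs …) (window τ N))` by `rfl`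
  haveI hνP' : IsProbabilityMeasure (tiltedGibbs σ a θ u₀ φ g τ N Φ) := hνP
  have hνac' : tiltedGibbs σ a θ u₀ φ g τ N Φ ≪ gibbs σ a θ u₀ N Φ := hνac
  have hνkl' : klDiv (tiltedGibbs σ a θ u₀ φ g τ N Φ) (gibbs σ a θ u₀ N Φ) ≠ ⊤ := hνkl
  have hn : (0 : ℝ) < ((N + 1 : ℕ) : ℝ) := by positivity
  -- the entropy `S = KL(G_N^X ‖ G_N) ≤ ε (N+1)`
  have hSle : (klDiv (tiltedGibbs σ a θ u₀ φ g τ N Φ) (gibbs σ a θ u₀ N Φ)).toReal ≤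
      min η' 1 * ((N + 1 : ℕ) : ℝ) :=
    ENNReal.toReal_le_of_le_ofReal (by positivity) hKL
  have hSη : (klDiv (tiltedGibbs σ a θ u₀ φ g τ N Φ) (gibbs σ a θ u₀ N Φ)).toReal ≤
      η' * ((N + 1 : ℕ) : ℝ) :=
    hSle.trans (mul_le_mul_of_nonneg_right (min_le_left _ _) hn.le)
  have hS1 : (klDiv (tiltedGibbs σ a θ u₀ φ g τ N Φ) (gibbs σ a θ u₀ N Φ)).toReal ≤ ((N + 1 : ℕ) : ℝ) :=
    hSle.trans ((mul_le_mul_of_nonneg_right (min_le_right _ _) hn.le).trans_eq (one_mul _))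
  -- per-time bound of the cut production
  have key : ∀ t : ℝ,
      production (cutDensity K θ u₀ Φ (tiltedGibbs σ a θ u₀ φ g τ N Φ) t) ≤ ENNReal.ofReal η := by
    intro t
    obtain ⟨hfP, hfac, -⟩ :=
      stub_oneBodyMarginal σ a θ u₀ N Φ (tiltedGibbs σ a θ u₀ φ g τ N Φ) hνP' hθ hνac' t
    haveI : IsProbabilityMeasure (oneBodyLaw θ u₀ Φ (tiltedGibbs σ a θ u₀ φ g τ N Φ) t) := hfP
    obtain ⟨hvne, hvle⟩ := stub_velocityEntropyBudget σ a θ u₀ N Φ (tiltedGibbs σ a θ u₀ φ g τ N Φ)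
      hνP' ha hθ hσ2 hνac' hνkl' t
    have hmom := H2 σ a θ u₀ N Φ (tiltedGibbs σ a θ u₀ φ g τ N Φ) hνP' ha hθ hσ2 hνkl' t
    -- velocity entropy `≤ η'`
    have hv : velKL (oneBodyLaw θ u₀ Φ (tiltedGibbs σ a θ u₀ φ g τ N Φ) t) ≤ ENNReal.ofReal η' := by
      rw [← ENNReal.ofReal_toReal hvne]
      exact ENNReal.ofReal_le_ofReal (le_of_mul_le_of_le_mul hn hvle hSη)
    -- second velocity moment `≤ c₂ + 4`
    have hm : ∫⁻ y, ‖y.2‖ₑ ^ 2 ∂(oneBodyLaw θ u₀ Φ (tiltedGibbs σ a θ u₀ φ g τ N Φ) t) ≤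
        ENNReal.ofReal (c₂ + 4) :=
      hmom.trans (ENNReal.ofReal_le_ofReal (moment_bound_arith hn hS1))
    have hprod := HPC _ hfP hfac hm hv
    rw [stub_hTheoremObjectsD]
    exact hprod
  exact setLIntegral_Ioo_le_of_le (window τ N) hη.le key

end Summit.AtomisticToContinuum.HydrodynamicLimit.Theorems.HTheorem

end
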